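import Mathlib.RepresentationTheory.Homological.GroupCohomology.Basic
import Mathlib.Algebra.Homology.ShortComplex.ModuleCat
import HarnessLib

/-!
# When is the class of an `n`-cocycle zero?  (`groupCohomology.π` in every degree)

Mathlib's `groupCohomology.π A n : Zⁿ(G, A) → Hⁿ(G, A)` is the quotient map from the inhomogeneous
`n`-cocycles; in degrees `1` and `2` Mathlib provides `H1π_eq_zero_iff` / `H2π_eq_zero_iff` (class zero
iff coboundary).  This file proves the statement in EVERY degree, straight from the `ModuleCat`
homology API (`ShortComplex.moduleCatLeftHomologyData`: cycles = `ker d`, homology = `ker d / im d`):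

* `groupCohomology_π_eq_zero_iff` — for `x ∈ Zⁿ⁺¹(G, A)`, `π x = 0 ↔ ∃ y : Cⁿ(G, A), d y = x`;
* `groupCohomology_π_eq_iff` — `π x = π x' ↔ ∃ y, d y = x - x'`;
* `groupCohomology_π_eq_zero_of_d_eq` — classes of coboundaries vanish (any degree).

Theorems only.  Used by the cone-period realisation of closed equivariant forms in the cohomology of
arithmetic groups (the non-vanishing of a class is argued from "not a coboundary").

## References

* K. S. Brown, *Cohomology of Groups*, GTM 87 (1982), III §1. [Brown1982CohomologyGroups]
-/

noncomputable section

open CategoryTheory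

universe u

namespace Literature.Algebra.Homology

variable {k G : Type u} [CommRing k] [Group G] (A : Rep k G)

/-- For a short complex of modules, `homologyπ x = 0` iff the cycle `x` is a boundary:
`∃ y, f y = i x`. [folklore] -/
theorem ShortComplex.moduleCat_homologyπ_eq_zero_iff (S : ShortComplex (ModuleCat.{u} k))
    (x : S.cycles) : S.homologyπ x = 0 ↔ ∃ y : S.X₁, S.f y = S.iCycles x := by
  constructor
  · intro hx
    have h1 : S.moduleCatHomologyIso.hom (S.homologyπ x) = 0 := by rw [hx, map_zero]
    rw [ShortComplex.π_moduleCatCyclesIso_hom_apply] at h1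
    change (LinearMap.range S.moduleCatToCycles).mkQ (S.moduleCatCyclesIso.hom x) = 0 at h1
    rw [Submodule.mkQ_apply, Submodule.Quotient.mk_eq_zero, LinearMap.mem_range] at h1
    obtain ⟨y, hy⟩ := h1
    refine ⟨y, ?_⟩
    have h2 := congrArg (fun z : LinearMap.ker S.g.hom => (z : S.X₂)) hy
    simp only [LinearMap.codRestrict_apply] at h2
    rw [h2]
    exact (ShortComplex.moduleCatCyclesIso_hom_i_apply S x)
  · rintro ⟨y, hy⟩
    have hinj : Function.Injective S.moduleCatHomologyIso.hom :=
      (ModuleCat.mono_iff_injective _).1 inferInstance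
    apply hinj
    rw [map_zero, ShortComplex.π_moduleCatCyclesIso_hom_apply]
    change (LinearMap.range S.moduleCatToCycles).mkQ (S.moduleCatCyclesIso.hom x) = 0
    rw [Submodule.mkQ_apply, Submodule.Quotient.mk_eq_zero, LinearMap.mem_range]
    refine ⟨y, Subtype.ext ?_⟩
    simp only [LinearMap.codRestrict_apply]
    rw [hy]
    exact (ShortComplex.moduleCatCyclesIso_hom_i_apply S x).symm

/-- **The class of an `(n+1)`-cocycle vanishes iff it is a coboundary**:
`groupCohomology.π A (n+1) x = 0 ↔ ∃ y : (Fin n → G) → A, d y = x` (Mathlib's inhomogeneous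
differential `inhomogeneousCochains.d A n`). [cite: Brown1982CohomologyGroups, III §1] -/
theorem groupCohomology_π_eq_zero_iff (n : ℕ) (x : groupCohomology.cocycles A (n + 1)) :
    groupCohomology.π A (n + 1) x = 0 ↔
      ∃ y : (Fin n → G) → A, inhomogeneousCochains.d A n y = groupCohomology.iCocycles A (n + 1) x := by
  have h := ShortComplex.moduleCat_homologyπ_eq_zero_iff
    ((groupCohomology.inhomogeneousCochains A).sc (n + 1)) x
  refine h.trans ?_
  have hprev : (ComplexShape.up ℕ).prev (n + 1) = n := CochainComplex.prev_nat_succ n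
  have hdn : (groupCohomology.inhomogeneousCochains A).d n (n + 1) = inhomogeneousCochains.d A n := by
    simp [groupCohomology.inhomogeneousCochains]
  constructor
  · rintro ⟨y, hy⟩
    refine ⟨((groupCohomology.inhomogeneousCochains A).XIsoOfEq hprev).hom y, ?_⟩
    rw [← hdn]
    change (((groupCohomology.inhomogeneousCochains A).XIsoOfEq hprev).hom ≫
      (groupCohomology.inhomogeneousCochains A).d n (n + 1)) y = _
    rw [(groupCohomology.inhomogeneousCochains A).XIsoOfEq_hom_comp_d hprev (n + 1)]
    exact hy
  · rintro ⟨y, hy⟩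
    refine ⟨((groupCohomology.inhomogeneousCochains A).XIsoOfEq hprev).inv y, ?_⟩
    change (((groupCohomology.inhomogeneousCochains A).XIsoOfEq hprev).inv ≫
      (groupCohomology.inhomogeneousCochains A).d ((ComplexShape.up ℕ).prev (n + 1)) (n + 1)) y = _
    rw [(groupCohomology.inhomogeneousCochains A).XIsoOfEq_inv_comp_d hprev (n + 1), hdn]
    exact hy

/-- Two `(n+1)`-cocycles have the same class iff they differ by a coboundary.
[cite: Brown1982CohomologyGroups, III §1] -/
theorem groupCohomology_π_eq_iff (n : ℕ) (x x' : groupCohomology.cocycles A (n + 1)) :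
    groupCohomology.π A (n + 1) x = groupCohomology.π A (n + 1) x' ↔
      ∃ y : (Fin n → G) → A, inhomogeneousCochains.d A n y =
        groupCohomology.iCocycles A (n + 1) x - groupCohomology.iCocycles A (n + 1) x' := by
  rw [← sub_eq_zero, ← map_sub, groupCohomology_π_eq_zero_iff, map_sub]

/-- **Classes of coboundaries vanish** (any degree): if `d y = x` then `π x = 0`.
[cite: Brown1982CohomologyGroups, III §1] -/
theorem groupCohomology_π_eq_zero_of_d_eq (n : ℕ) (x : groupCohomology.cocycles A (n + 1))
    (y : (Fin n → G) → A)
    (hy : inhomogeneousCochains.d A n y = groupCohomology.iCocycles A (n + 1) x) :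
    groupCohomology.π A (n + 1) x = 0 :=
  (groupCohomology_π_eq_zero_iff A n x).2 ⟨y, hy⟩

end Literature.Algebra.Homology

end
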